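import Summits.CriticalPhenomena.CardyFormulaZ2.Theorems.CardyUniqueLimitCardyRigiditySlitCrossingBulk
import Literature.Probability.RandomPlanarGeometry.JordanBoundaryWinding
import Literature.Probability.RandomPlanarGeometry.PolygonWinding
import HarnessLib

/-!
# Uniform bulk along Jordan domains with uniformly converging boundary loops

Crux `Summit.CriticalPhenomena.CardyFormulaZ2.Theses.CardyUniqueLimit.CardyRigidity`
(stmt-CriticalPhenomena-0746), line `crossing_martingale`, stub `stub_slitObservableApprox`,
piece **(P-bulk), Jordan form**.  The metric sandwich hypotheses of
`Bulk.eventually_forall_mem_meshDomain_of_sandwich` / `Bulk.eventually_mem_meshDomain_of_depth`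
(…SlitCrossingBulk.lean) hold for Jordan domains `D_k` whose boundary loops converge UNIFORMLY
(as parametrised loops) to the boundary loop of a Jordan domain `D`: by Rouché's principle for
loops (`wind_eq_of_norm_sub_lt`) the two boundary loops wind equally around every point at
distance `≥ ε` from `∂D`, and a Jordan domain is the set of off-boundary points with nonzero
winding number (`JordanDomain.wind_boundary_sub_ne_zero`, `JordanDomain.mem_carrier_of_wind_ne_zero`).

* `Bulk.subset_carrier_of_close`, `Bulk.carrier_subset_of_close`, `Bulk.frontier_subset_of_close`
  — inner / outer / frontier containments for `ε`-close boundary loops;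
* `Bulk.eventually_bulk_of_jordan` — for `D` with Lebesgue-null boundary curve: (i) lattice
  points of a compact `K ⊆ D` eventually lie in `meshDomain D_k δ_k`, a single mesh component;
  (ii) for every depth `m₂ > 0`, eventually every mesh vertex of `D_k` at distance `≥ m₂` from
  `∂D_k` lies in `meshDomain D_k δ_k` — hypothesis `hbulk` of `Transfer.h6_of_bulk` for the
  flower-sandwich transfer lemma, uniformly along the family.
(Hausdorff closeness of the boundary SETS would not suffice: a thin loop doubling back along a
circle is Hausdorff-close to it and encloses almost nothing.)  Folklore.
-/

namespace Summit.CriticalPhenomena.CardyFormulaZ2.Cruxes.CardyRigidity.CrossingMartingale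

namespace Bulk

open Set Metric MeasureTheory Filter Topology
open Literature.Probability.LatticeModels Literature.Probability.RandomPlanarGeometry
open Literature.Topology.PlaneTopology

noncomputable section

variable {D D' : JordanDomain} {ε : ℝ}

/-- The boundary loop minus an off-boundary point is a nonvanishing loop. [folklore] -/
theorem isNonvanishingLoop_boundary_sub (D : JordanDomain) {z : ℂ} (hz : z ∉ frontier D.carrier) :
    IsNonvanishingLoop fun t => D.boundary t - z := by
  refine ⟨(D.continuous_boundary.sub continuous_const).continuousOn, fun t _ h => hz ?_, ?_⟩
  · rw [← sub_eq_zero.1 h, ← D.range_boundary]; exact mem_range_self t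
  · have := D.periodic_boundary 0
    simp only [zero_add] at this
    simp [this]

/-- **Rouché for close boundary loops**: if the boundary loops of `D'` and `D` are uniformly
`ε`-close and `z` is at distance `≥ ε` from `∂D`, the two loops wind equally around `z`.
[folklore] -/
theorem wind_boundary_sub_eq_of_close (h : ∀ t, dist (D'.boundary t) (D.boundary t) < ε) {z : ℂ}
    (hz : ∀ t, ε ≤ dist z (D.boundary t)) :
    wind (fun t => D'.boundary t - z) = wind (fun t => D.boundary t - z) := by
  have hzfr : z ∉ frontier D.carrier := by
    rw [← D.range_boundary]
    rintro ⟨t, rfl⟩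
    have := hz t
    rw [dist_self] at this
    linarith [(dist_nonneg.trans_lt (h t))]
  refine wind_eq_of_norm_sub_lt ((D'.continuous_boundary.sub continuous_const).continuousOn)
    ?_ (isNonvanishingLoop_boundary_sub D hzfr) fun t _ => ?_
  · have := D'.periodic_boundary 0
    simp only [zero_add] at this
    simp [this]
  · calc ‖D'.boundary t - z - (D.boundary t - z)‖ = dist (D'.boundary t) (D.boundary t) := by
          rw [dist_eq_norm]; ring_nf
      _ < ε := h t
      _ ≤ ‖D.boundary t - z‖ := by rw [← dist_eq_norm, dist_comm]; exact hz t

/-- **Inner containment**: points of `D` at distance `≥ ε` from `Dᶜ` lie in every Jordan domain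
whose boundary loop is uniformly `ε`-close to that of `D`. [folklore] -/
theorem subset_carrier_of_close (h : ∀ t, dist (D'.boundary t) (D.boundary t) < ε) :
    {z ∈ D.carrier | ε ≤ infDist z D.carrierᶜ} ⊆ D'.carrier := by
  rintro z ⟨hzD, hzε⟩
  have hne : D.carrierᶜ.Nonempty :=
    nonempty_compl.2 fun hu => NormedSpace.unbounded_univ ℝ ℂ (hu ▸ D.isBounded)
  have hz : ∀ t, ε ≤ dist z (D.boundary t) := fun t =>
    hzε.trans (infDist_le_dist_of_mem (Set.disjoint_left.1 D.disjoint_carrier_frontier.symm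
      (D.range_boundary ▸ mem_range_self t) |> fun h' => h'))
  have hw := wind_boundary_sub_eq_of_close h hz
  have hzfr' : z ∉ frontier D'.carrier := by
    rw [← D'.range_boundary]
    rintro ⟨t, rfl⟩
    linarith [h t, hz t, dist_comm (D'.boundary t) (D.boundary t)]
  exact D'.mem_carrier_of_wind_ne_zero hzfr' (hw ▸ D.wind_boundary_sub_ne_zero hzD)

/-- **Outer containment**: a Jordan domain whose boundary loop is uniformly `ε`-close to that
of `D` lies within `ε` of `D`. [folklore] -/
theorem carrier_subset_of_close (h : ∀ t, dist (D'.boundary t) (D.boundary t) < ε) :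
    D'.carrier ⊆ {z | infDist z D.carrier < ε} := by
  intro z hzD'
  by_contra hzε
  have hzε' : ε ≤ infDist z D.carrier := not_lt.1 hzε
  have hε : 0 < ε := dist_nonneg.trans_lt (h 0)
  have hzcl : z ∉ closure D.carrier := fun hc => by
    rw [mem_closure_iff_infDist_zero D.isConnected.nonempty] at hc
    linarith
  have hzfr : z ∉ frontier D.carrier := fun hf => hzcl (frontier_subset_closure hf)
  have hz : ∀ t, ε ≤ dist z (D.boundary t) := fun t => by
    have hbt : D.boundary t ∈ closure D.carrier :=
      frontier_subset_closure (D.range_boundary ▸ mem_range_self t)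
    calc ε ≤ infDist z D.carrier := hzε'
      _ = infDist z (closure D.carrier) := infDist_closure.symm
      _ ≤ dist z (D.boundary t) := infDist_le_dist_of_mem hbt
  have hw0 : wind (fun t => D.boundary t - z) = 0 := by
    by_contra hw
    exact hzcl (subset_closure (D.mem_carrier_of_wind_ne_zero hzfr hw))
  have hw := wind_boundary_sub_eq_of_close h hz
  exact D'.wind_boundary_sub_ne_zero hzD' (hw.trans hw0)

/-- **Frontier closeness**: `∂D` lies within `ε` of `∂D'`. [folklore] -/
theorem frontier_subset_of_close (h : ∀ t, dist (D'.boundary t) (D.boundary t) < ε) :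
    frontier D.carrier ⊆ {z | infDist z (frontier D'.carrier) < ε} := by
  rw [← D.range_boundary]
  rintro _ ⟨t, rfl⟩
  have hbt : D'.boundary t ∈ frontier D'.carrier := D'.range_boundary ▸ mem_range_self t
  calc infDist (D.boundary t) (frontier D'.carrier) ≤ dist (D.boundary t) (D'.boundary t) :=
        infDist_le_dist_of_mem hbt
    _ < ε := by rw [dist_comm]; exact h t

/-- **Uniform bulk for Jordan domains with uniformly converging boundary loops.**  Let `D` be
a Jordan domain with Lebesgue-null boundary curve and `D_k` Jordan domains whose boundary loops
converge to that of `D` uniformly (same parametrisation) along a filter `l`, with meshes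
`δ_k > 0`, `δ_k → 0`.  Then (i) for every compact `K ⊆ D`, eventually every lattice point of
`δ_k ℤ²` in `K` lies in `meshDomain D_k δ_k`, a single mesh component; (ii) for every depth
`m₂ > 0`, eventually every mesh vertex of `D_k` at distance `≥ m₂` from `∂D_k` lies in
`meshDomain D_k δ_k` (hypothesis `hbulk` of `Transfer.h6_of_bulk`). [folklore] -/
theorem eventually_bulk_of_jordan {ι : Type*} {l : Filter ι} (D : JordanDomain)
    (hDf : volume (frontier D.carrier) = 0) (Ds : ι → JordanDomain) (δs : ι → ℝ)
    (hδ : ∀ᶠ k in l, 0 < δs k) (hδ0 : Tendsto δs l (𝓝 0))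
    (hclose : ∀ ε : ℝ, 0 < ε → ∀ᶠ k in l, ∀ t, dist ((Ds k).boundary t) (D.boundary t) < ε) :
    (∀ K : Set ℂ, IsCompact K → K ⊆ D.carrier → ∀ᶠ k in l,
      (∀ x : Site 2, meshPoint (δs k) x ∈ K → x ∈ meshDomain (Ds k).carrier (δs k)) ∧
      (∀ x ∈ meshDomain (Ds k).carrier (δs k), ∀ y ∈ meshDomain (Ds k).carrier (δs k),
        ∃ (hx : x ∈ meshVertices (Ds k).carrier (δs k)) (hy : y ∈ meshVertices (Ds k).carrier (δs k)),
          (meshVertexGraph (Ds k).carrier (δs k)).Reachable ⟨x, hx⟩ ⟨y, hy⟩)) ∧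
    (∀ m₂ : ℝ, 0 < m₂ → ∀ᶠ k in l, ∀ v : Site 2, meshPoint (δs k) v ∈ (Ds k).carrier →
      m₂ ≤ infDist (meshPoint (δs k) v) (frontier (Ds k).carrier) →
        v ∈ meshDomain (Ds k).carrier (δs k)) := by
  have hin : ∀ ε : ℝ, 0 < ε → ∀ᶠ k in l,
      {z ∈ D.carrier | ε ≤ infDist z D.carrierᶜ} ⊆ (Ds k).carrier := fun ε hε =>
    (hclose ε hε).mono fun k hk => subset_carrier_of_close hk
  have hout : ∀ ε : ℝ, 0 < ε → ∀ᶠ k in l, (Ds k).carrier ⊆ {z | infDist z D.carrier < ε} :=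
    fun ε hε => (hclose ε hε).mono fun k hk => carrier_subset_of_close hk
  have hfr : ∀ ε : ℝ, 0 < ε → ∀ᶠ k in l,
      frontier D.carrier ⊆ {z | infDist z (frontier (Ds k).carrier) < ε} := fun ε hε =>
    (hclose ε hε).mono fun k hk => frontier_subset_of_close hk
  exact ⟨fun K hK hKD => eventually_forall_mem_meshDomain_of_sandwich D.isOpen D.isBounded
      D.isConnected hDf (fun k => (Ds k).carrier) δs hδ hδ0 hin hout hK hKD,
    fun m₂ hm₂ => eventually_mem_meshDomain_of_depth D.isOpen D.isBounded D.isConnected hDf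
      (fun k => (Ds k).carrier) δs hδ hδ0 hin hout hfr hm₂⟩

end

end Bulk

/-- **Registered form** (glue `bulk_eventually_bulk_of_jordan` of stmt-CriticalPhenomena-0746): uniform bulk of the
largest mesh component along Jordan domains whose boundary loops converge uniformly to that of a Jordan domain with
Lebesgue-null boundary curve, meshes `→ 0`: compact form and depth form. [folklore] -/
theorem bulk_eventually_bulk_of_jordan : ∀ {ι : Type*} {l : Filter ι} (D : Literature.Probability.RandomPlanarGeometry.JordanDomain), MeasureTheory.volume (frontier D.carrier) = 0 → ∀ (Ds : ι → Literature.Probability.RandomPlanarGeometry.JordanDomain) (δs : ι → ℝ), (∀ᶠ k in l, 0 < δs k) → Filter.Tendsto δs l (nhds 0) → (∀ ε : ℝ, 0 < ε → ∀ᶠ k in l, ∀ t, dist ((Ds k).boundary t) (D.boundary t) < ε) → (∀ K : Set ℂ, IsCompact K → K ⊆ D.carrier → ∀ᶠ k in l, (∀ x : Literature.Probability.LatticeModels.Site 2, Literature.Probability.LatticeModels.meshPoint (δs k) x ∈ K → x ∈ Literature.Probability.LatticeModels.meshDomain (Ds k).carrier (δs k)) ∧ (∀ x ∈ Literature.Probability.LatticeModels.meshDomain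 (Ds k).carrier (δs k), ∀ y ∈ Literature.Probability.LatticeModels.meshDomain (Ds k).carrier (δs k), ∃ (hx : x ∈ Literature.Probability.LatticeModels.meshVertices (Ds k).carrier (δs k)) (hy : y ∈ Literature.Probability.LatticeModels.meshVertices (Ds k).carrier (δs k)), (Literature.Probability.LatticeModels.meshVertexGraph (Ds k).carrier (δs k)).Reachable ⟨x, hx⟩ ⟨y, hy⟩)) ∧ (∀ m₂ : ℝ, 0 < m₂ → ∀ᶠ k in l, ∀ v : Literature.Probability.LatticeModels.Site 2, Literature.Probability.LatticeModels.meshPoint (δs k) v ∈ (Ds k).carrier → m₂ ≤ Metric.infDist (Literature.Probability.LatticeModels.meshPoint (δs k) v) (frontier (Ds k).carrier) → v ∈ Literature.Probability.LatticeModels.meshDomain (Ds k).carrier (δs k)) :=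
  fun D hDf Ds δs hδ hδ0 hclose ↦ Bulk.eventually_bulk_of_jordan D hDf Ds δs hδ hδ0 hclose

end Summit.CriticalPhenomena.CardyFormulaZ2.Cruxes.CardyRigidity.CrossingMartingale
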